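import Literature.RingTheory.KTheory.KZeroField
import Mathlib.Topology.ContinuousMap.Algebra
import Mathlib.Topology.Instances.Matrix
import Mathlib.Analysis.Complex.Basic
import HarnessLib

/-!
# Topological `K`-theory: `K⁰(X) = K₀(C(X, ℂ))`, pull-backs, rank, reduced `K⁰`

The complex `K`-group of a topological space in the Serre–Swan / idempotent model of
Husemöller–Joachim–Jurčo–Schottenloher, *Basic Bundle Theory and K-Cohomology Invariants*, Ch. 3
§§4–5 and Ch. 4 §§2–4: for compact `X` the section functor identifies vector bundles on `X` with
finitely generated projective `C(X)`-modules (Ch. 3 Thm. 4.2) and these with algebraic equivalence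
classes of idempotent matrices over `C(X)` (Ch. 3 §5), so that `K(X) ≅ K(C(X)) ≅ I(C(X))`
(Ch. 4 Thm. 3.5, Thm. 4.5). We take the last group as the definition and develop:

* `K0 X := KZero C(X, ℂ)` (an `abbrev`, so the whole `KZero` API applies);
* `comapRingHom f : C(Y, ℂ) →+* C(X, ℂ)` and **`pullback f : K0 Y →+ K0 X`** (`f^*`), with
  `pullback_id`, `pullback_comp` (contravariant functor; Ch. 4 Rem. 2.4, Thm. 3.5);
* `evalRingHom x`, **`rankAt x : K0 X →+ ℤ`** (`K(X) → K({x}) = ℤ`, Ch. 4 Rem. 2.6), `rankAt_of`,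
  `rankAt_of_unit`, `rankAt_pullback`, `rankAt_unitHom`;
* the dictionary between idempotent matrices over `C(X, ℂ)` and continuous families of idempotent
  matrices: `matrixSwap : Mₘₙ(C(X, ℂ)) → C(X, Mₘₙ(ℂ))`, `matrixUnswap`, `matrixSwapEquiv`,
  `matFun p` (`x ↦ p(x)`), `idemOfFun P` and **`algEquivalent_of_conj`**: pointwise-conjugate
  families (`Q(x) = U(x) P(x) V(x)`, `V U = 1`, `U, V` continuous) are algebraically equivalent
  over `C(X, ℂ)` — the bridge used by homotopy invariance (`HomotopyInvariance.lean`);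
* `KZero.mapEquiv` (ring isomorphisms induce isomorphisms), `evalRingEquiv`, **`rankAtEquiv`**:
  `K⁰(pt) ≃+ ℤ` (Ch. 4 Rem. 2.4);
* **reduced `K`-theory** `Reduced X x₀ = ker rank_{x₀}` with the splitting
  `a - rank_{x₀}(a) • [1] ∈ K̃⁰` (Ch. 4 Rem. 2.6), `of_sub_of_mem_reduced_iff`,
  `pullback_mem_reduced`.

Everything is proved; there are no named facts. Compactness of `X` is not needed in this file.

## References

* D. Husemöller, M. Joachim, B. Jurčo, M. Schottenloher, *Basic Bundle Theory and K-Cohomology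
  Invariants*, LNP 726, Springer (2008) [HusemollerEtAl2008] (held; PDF pp. 145–153): Ch. 3
  Rem. 4.5 (`C(f)`), Prop. 5.8; Ch. 4 Def. 2.3 (`K(X)`), Rem. 2.4 (`K(*) → ℤ` iso), Rem. 2.5,
  Rem. 2.6 (`K(X) = ℤ ⊕ K(X, *)`), Thm. 3.5 (`K(X) ≅ K(C(X))`, naturality in `f`), §4 (`I(R)`),
  Thm. 4.5.

## Design notes

* `K0 X` is defined for every topological space; the theorems that need compactness
  (homotopy invariance, exactness) assume `[CompactSpace X]` where they are proved. For
  non-compact `X` this group is `K₀` of the ring `C(X, ℂ)`, not representable `K`-theory.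
* Scalars are `ℂ` throughout (complex `K`-theory); the real case would be the same file with `ℝ`.
* Not here: homotopy invariance (`HomotopyInvariance.lean`), the exact sequence of a pair,
  products, Bott periodicity.
* Mathlib searches: `ContinuousMap.compRightAlgHom`, `ContinuousMap.evalAlgHom`,
  `continuous_matrix`, `Continuous.matrix_elem` (used); Mathlib has `VectorBundle` but no
  `K`-theory of spaces and no `C(X)`-module/idempotent dictionary. Nothing restated.
-/

noncomputable section

/-- `Idem.map` fixes the identity idempotents: `f(1ₙ) = 1ₙ`. [folklore] -/
theorem Literature.RingTheory.KTheory.Idem.map_unit {R S : Type*} [Ring R] [Ring S] (f : R →+* S)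
    (n : ℕ) : (Literature.RingTheory.KTheory.Idem.unit n : Literature.RingTheory.KTheory.Idem R).map f =
      Literature.RingTheory.KTheory.Idem.unit n :=
  Literature.RingTheory.KTheory.Idem.mk_eq_mk_of_eq _ _ (Matrix.map_one f (_root_.map_zero f) (_root_.map_one f))

namespace Literature.AlgebraicTopology.KTheory

open Literature.RingTheory.KTheory Matrix

universe u v w

variable {X : Type u} {Y : Type v} {Z : Type w}
  [TopologicalSpace X] [TopologicalSpace Y] [TopologicalSpace Z]

/-- **`K⁰(X)`**, the complex topological `K`-group of a space `X`, defined as `K₀` of the ring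
`C(X, ℂ)` of continuous complex functions via idempotent matrices (for compact `X` this is the
Grothendieck group of complex vector bundles on `X`, by Serre–Swan: Husemöller et al., Ch. 3
Thm. 4.2 / Ch. 4 Thm. 3.5, Thm. 4.5). [cite: HusemollerEtAl2008, Ch. 4 Thm. 3.5] -/
abbrev K0 (X : Type u) [TopologicalSpace X] : Type u := KZero C(X, ℂ)

/-- The ring homomorphism `C(Y, ℂ) → C(X, ℂ)`, `g ↦ g ∘ f`, of a continuous map `f : X → Y`.
[cite: HusemollerEtAl2008, Ch. 3 Rem. 4.5] -/
def comapRingHom (f : C(X, Y)) : C(Y, ℂ) →+* C(X, ℂ) :=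
  (ContinuousMap.compRightAlgHom ℂ ℂ f).toRingHom

/-- `comapRingHom f h = h ∘ f`. [cite: HusemollerEtAl2008, Ch. 3 Rem. 4.5] -/
@[simp] theorem comapRingHom_apply (f : C(X, Y)) (h : C(Y, ℂ)) : comapRingHom f h = h.comp f := rfl

/-- `C(id) = id`. [cite: HusemollerEtAl2008, Ch. 3 Rem. 4.5] -/
theorem comapRingHom_id : comapRingHom (ContinuousMap.id X) = RingHom.id C(X, ℂ) :=
  RingHom.ext fun _ ↦ ContinuousMap.ext fun _ ↦ rfl

/-- `C(g ∘ f) = C(f) ∘ C(g)`. [cite: HusemollerEtAl2008, Ch. 3 Rem. 4.5] -/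
theorem comapRingHom_comp (f : C(X, Y)) (g : C(Y, Z)) :
    comapRingHom (g.comp f) = (comapRingHom f).comp (comapRingHom g) :=
  RingHom.ext fun _ ↦ ContinuousMap.ext fun _ ↦ rfl

/-- **`f^* : K⁰(Y) → K⁰(X)`**, the pull-back along a continuous map (`K(f) = K(C(f))`,
Husemöller et al., Ch. 4 Thm. 3.5 / Rem. 4.4). [cite: HusemollerEtAl2008, Ch. 4 Thm. 3.5] -/
noncomputable def pullback (f : C(X, Y)) : K0 Y →+ K0 X := KZero.map (comapRingHom f)

/-- `f^* [p] = [f^* p]` on classes of idempotents. [cite: HusemollerEtAl2008, Ch. 4 Thm. 3.5] -/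
theorem pullback_of (f : C(X, Y)) (p : Idem C(Y, ℂ)) :
    pullback f (KZero.of p) = KZero.of (p.map (comapRingHom f)) := KZero.map_of _ _

/-- `id^* = id`. [cite: HusemollerEtAl2008, Ch. 4 Rem. 2.4] -/
theorem pullback_id : pullback (ContinuousMap.id X) = AddMonoidHom.id (K0 X) := by
  rw [pullback, comapRingHom_id, KZero.map_id]

/-- `(g ∘ f)^* = f^* ∘ g^*` (contravariant functoriality). [cite: HusemollerEtAl2008, Ch. 4 Rem. 2.4] -/
theorem pullback_comp (f : C(X, Y)) (g : C(Y, Z)) :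
    pullback (g.comp f) = (pullback f).comp (pullback g) := by
  rw [pullback, comapRingHom_comp, KZero.map_comp]; rfl

/-- Evaluation at a point as a ring homomorphism `C(X, ℂ) → ℂ`. [folklore] -/
def evalRingHom (x : X) : C(X, ℂ) →+* ℂ := (ContinuousMap.evalAlgHom ℂ ℂ x).toRingHom

/-- `evalRingHom x g = g x`. [folklore] -/
@[simp] theorem evalRingHom_apply (x : X) (g : C(X, ℂ)) : evalRingHom x g = g x := rfl

/-- Evaluation after pull-back is evaluation at the image point. [folklore] -/
theorem evalRingHom_comp_comapRingHom (f : C(X, Y)) (x : X) :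
    (evalRingHom x).comp (comapRingHom f) = evalRingHom (f x) :=
  RingHom.ext fun _ ↦ rfl

/-- **The rank at a point** `x`: `K⁰(X) → K⁰({x}) = K₀(ℂ) ≅ ℤ` (Husemöller et al., Ch. 4
Rem. 2.6). [cite: HusemollerEtAl2008, Ch. 4 Rem. 2.6] -/
noncomputable def rankAt (x : X) : K0 X →+ ℤ :=
  (KZero.rankEquiv (K := ℂ)).toAddMonoidHom.comp (KZero.map (evalRingHom x))

/-- `rank_x [p] = rank p(x)`. [cite: HusemollerEtAl2008, Ch. 4 Rem. 2.6] -/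
theorem rankAt_of (x : X) (p : Idem C(X, ℂ)) :
    rankAt x (KZero.of p) = (p.map (evalRingHom x)).rank := by
  simp [rankAt, KZero.rankEquiv_of]

/-- The rank of the trivial class `[1ₙ]` is `n` everywhere. [cite: HusemollerEtAl2008, Ch. 4 Rem. 2.5] -/
theorem rankAt_of_unit (x : X) (n : ℕ) : rankAt x (KZero.of (Idem.unit n)) = n := by
  rw [rankAt_of, Idem.map_unit, Idem.rank_unit]

/-- Ranks are preserved by pull-back: `rank_x (f^* a) = rank_{f x} a`. [cite: HusemollerEtAl2008, Ch. 4 Rem. 2.6] -/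
theorem rankAt_pullback (f : C(X, Y)) (x : X) (a : K0 Y) :
    rankAt x (pullback f a) = rankAt (f x) a := by
  change ((rankAt x).comp (pullback f)) a = rankAt (f x) a
  congr 1
  rw [rankAt, pullback, AddMonoidHom.comp_assoc, ← KZero.map_comp, evalRingHom_comp_comapRingHom]
  rfl

/-! ### Idempotents over `C(X, ℂ)` as continuous families of idempotent matrices -/

section swap

variable {m n : Type*}

/-- A matrix of continuous functions is a continuous matrix-valued function. [folklore] -/
def matrixSwap (M : Matrix m n C(X, ℂ)) : C(X, Matrix m n ℂ) :=
  ⟨fun x ↦ M.map (fun g : C(X, ℂ) ↦ g x), continuous_matrix fun i j ↦ (M i j).continuous⟩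

/-- `matrixSwap M x = (g ↦ g x) applied entrywise. [folklore] -/
@[simp] theorem matrixSwap_apply (M : Matrix m n C(X, ℂ)) (x : X) :
    matrixSwap M x = M.map (fun g : C(X, ℂ) ↦ g x) := rfl

/-- A continuous matrix-valued function is a matrix of continuous functions. [folklore] -/
def matrixUnswap (F : C(X, Matrix m n ℂ)) : Matrix m n C(X, ℂ) :=
  Matrix.of fun i j ↦ ⟨fun x ↦ F x i j, F.continuous.matrix_elem i j⟩

/-- Entries of `matrixUnswap F`. [folklore] -/
@[simp] theorem matrixUnswap_apply (F : C(X, Matrix m n ℂ)) (i : m) (j : n) (x : X) :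
    matrixUnswap F i j x = F x i j := rfl

variable (X m n) in
/-- `Mₘₙ(C(X, ℂ)) ≃ C(X, Mₘₙ(ℂ))`. [folklore] -/
def matrixSwapEquiv : Matrix m n C(X, ℂ) ≃ C(X, Matrix m n ℂ) where
  toFun := matrixSwap
  invFun := matrixUnswap
  left_inv M := by ext i j x; rfl
  right_inv F := by ext x i j; rfl

/-- `matrixSwap` is multiplicative (evaluation is a ring homomorphism). [folklore] -/
theorem matrixSwap_mul [Fintype n] {l : Type*} (M : Matrix m n C(X, ℂ)) (N : Matrix n l C(X, ℂ)) (x : X) :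
    matrixSwap (M * N) x = matrixSwap M x * matrixSwap N x := by
  change (M * N).map (evalRingHom x) = M.map (evalRingHom x) * N.map (evalRingHom x)
  exact Matrix.map_mul

/-- `matrixSwap 1 = 1`. [folklore] -/
theorem matrixSwap_one [DecidableEq n] (x : X) : matrixSwap (1 : Matrix n n C(X, ℂ)) x = 1 := by
  change (1 : Matrix n n C(X, ℂ)).map (evalRingHom x) = 1
  exact Matrix.map_one _ (map_zero _) (map_one _)

/-- `matrixSwap` is injective. [folklore] -/
theorem matrixSwap_injective : Function.Injective (matrixSwap : Matrix m n C(X, ℂ) → C(X, Matrix m n ℂ)) :=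
  (matrixSwapEquiv X m n).injective

end swap

/-- **Pointwise conjugate idempotent families are algebraically equivalent over `C(X, ℂ)`.** If
`P` is an idempotent matrix over `C(X, ℂ)` and `U, V : X → Mₙ(ℂ)` are continuous with
`V(x) U(x) = 1` and `Q(x) = U(x) P(x) V(x)` for all `x`, then `P ∼ Q`
(`AlgEquivalent.conj` over the ring `C(X, ℂ)`). [cite: HusemollerEtAl2008, Ch. 3 Prop. 5.8] -/
theorem algEquivalent_of_conj {n : Type*} [Fintype n] [DecidableEq n] {P Q : Matrix n n C(X, ℂ)}
    (hP : IsIdempotentElem P) (U V : C(X, Matrix n n ℂ)) (hVU : ∀ x, V x * U x = 1)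
    (hQ : ∀ x, matrixSwap Q x = U x * matrixSwap P x * V x) : AlgEquivalent P Q := by
  have hvu : matrixUnswap V * matrixUnswap U = 1 := matrixSwap_injective <| by
    ext x : 1
    rw [matrixSwap_mul, matrixSwap_one]
    exact hVU x
  have hq : Q = matrixUnswap U * P * matrixUnswap V := matrixSwap_injective <| by
    ext x : 1
    rw [matrixSwap_mul, matrixSwap_mul]
    exact hQ x
  rw [hq]
  exact AlgEquivalent.conj hP hvu

/-- The continuous family of idempotent matrices `x ↦ p(x)` of an idempotent over `C(X, ℂ)`. [folklore] -/
def matFun (p : Idem C(X, ℂ)) : C(X, Matrix (Fin p.size) (Fin p.size) ℂ) := matrixSwap p.mat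

/-- `matFun p x` is the matrix of the fibre `p(x)`. [folklore] -/
theorem matFun_apply (p : Idem C(X, ℂ)) (x : X) : matFun p x = (p.map (evalRingHom x)).mat := rfl

/-- Each value `p(x)` is an idempotent matrix. [folklore] -/
theorem isIdempotentElem_matFun (p : Idem C(X, ℂ)) (x : X) : IsIdempotentElem (matFun p x) :=
  (p.map (evalRingHom x)).isIdempotentElem

/-- The idempotent over `C(X, ℂ)` defined by a continuous family of idempotent matrices. [folklore] -/
def idemOfFun {n : ℕ} (P : C(X, Matrix (Fin n) (Fin n) ℂ)) (hP : ∀ x, IsIdempotentElem (P x)) :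
    Idem C(X, ℂ) :=
  ⟨n, matrixUnswap P, matrixSwap_injective <| by
    ext x : 1
    rw [matrixSwap_mul]
    exact (hP x).eq⟩

/-- `idemOfFun P` has the size of `P`. [folklore] -/
@[simp] theorem idemOfFun_size {n : ℕ} (P : C(X, Matrix (Fin n) (Fin n) ℂ)) (hP : ∀ x, IsIdempotentElem (P x)) :
    (idemOfFun P hP).size = n := rfl

/-- `matFun (idemOfFun P) = P`. [folklore] -/
theorem matFun_idemOfFun {n : ℕ} (P : C(X, Matrix (Fin n) (Fin n) ℂ)) (hP : ∀ x, IsIdempotentElem (P x)) :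
    matFun (idemOfFun P hP) = P := (matrixSwapEquiv X _ _).right_inv P

/-- `idemOfFun (matFun p) = p`. [folklore] -/
theorem idemOfFun_matFun (p : Idem C(X, ℂ)) :
    idemOfFun (matFun p) (isIdempotentElem_matFun p) = p := by
  cases p with
  | mk n M hM => exact Idem.mk_eq_mk_of_eq _ _ ((matrixSwapEquiv X _ _).left_inv M)

/-- Pull-back on families: `(f^* p)(x) = p(f x)`. [folklore] -/
theorem matFun_map_comapRingHom (f : C(X, Y)) (p : Idem C(Y, ℂ)) (x : X) :
    matFun (p.map (comapRingHom f)) x = matFun p (f x) := rfl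

/-! ### `K⁰` of a point; reduced `K⁰` -/

/-- `K₀` along a ring isomorphism is a group isomorphism. [cite: HusemollerEtAl2008, Ch. 4 Rem. 4.4] -/
def _root_.Literature.RingTheory.KTheory.KZero.mapEquiv {R S : Type*} [Ring R] [Ring S] (e : R ≃+* S) :
    KZero R ≃+ KZero S :=
  (KZero.map e.toRingHom).toAddEquiv (KZero.map e.symm.toRingHom)
    (by rw [← KZero.map_comp]; convert KZero.map_id (R := R); ext; simp)
    (by rw [← KZero.map_comp]; convert KZero.map_id (R := S); ext; simp)

/-- `mapEquiv e = map e` as a function. [cite: HusemollerEtAl2008, Ch. 4 Rem. 4.4] -/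
@[simp] theorem _root_.Literature.RingTheory.KTheory.KZero.mapEquiv_apply {R S : Type*} [Ring R] [Ring S]
    (e : R ≃+* S) (a : KZero R) : KZero.mapEquiv e a = KZero.map e.toRingHom a := rfl

/-- On a one-point space, evaluation `C(X, ℂ) ≃+* ℂ` (inverse: constants). [folklore] -/
def evalRingEquiv [Subsingleton X] (x : X) : C(X, ℂ) ≃+* ℂ :=
  { evalRingHom x with
    invFun := fun c ↦ ContinuousMap.const X c
    left_inv := fun g ↦ ContinuousMap.ext fun y ↦ by rw [Subsingleton.elim y x]; rfl
    right_inv := fun _ ↦ rfl }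

/-- **`K⁰(pt) = ℤ` by the rank** (Husemöller et al., Ch. 4 Rem. 2.4: "the algebraic morphism given
by dimension or rank `K(*) → ℤ` is an isomorphism"), for any one-point space.
[cite: HusemollerEtAl2008, Ch. 4 Rem. 2.4] -/
def rankAtEquiv [Subsingleton X] (x : X) : K0 X ≃+ ℤ :=
  (KZero.mapEquiv (evalRingEquiv x)).trans (KZero.rankEquiv (K := ℂ))

/-- `rankAtEquiv x` is `rankAt x`. [cite: HusemollerEtAl2008, Ch. 4 Rem. 2.4] -/
theorem rankAtEquiv_apply [Subsingleton X] (x : X) (a : K0 X) : rankAtEquiv x a = rankAt x a := rfl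

/-- The rank at `x₀` splits the unit map `ℤ → K⁰(X)`: `rank_{x₀} (n • [1]) = n`.
[cite: HusemollerEtAl2008, Ch. 4 Rem. 2.6] -/
theorem rankAt_unitHom (x : X) (n : ℤ) : rankAt x (KZero.unitHom C(X, ℂ) n) = n := by
  rw [KZero.unitHom_apply, map_zsmul, rankAt_of_unit, Nat.cast_one, smul_eq_mul, mul_one]

variable (X) in
/-- **Reduced `K`-theory** `K̃⁰(X, x₀) = ker (rank_{x₀} : K⁰(X) → ℤ)`, an additive subgroup of
`K⁰(X)` with `K⁰(X) = ℤ ⊕ K̃⁰(X, x₀)` (Husemöller et al., Ch. 4 Rem. 2.6; the ideal `K(X, *)`).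
[cite: HusemollerEtAl2008, Ch. 4 Rem. 2.6] -/
def Reduced (x₀ : X) : AddSubgroup (K0 X) := (rankAt x₀).ker

/-- Membership in `K̃⁰(X, x₀)`. [cite: HusemollerEtAl2008, Ch. 4 Rem. 2.6] -/
theorem mem_reduced_iff {x₀ : X} {a : K0 X} : a ∈ Reduced X x₀ ↔ rankAt x₀ a = 0 := Iff.rfl

/-- The splitting `K⁰(X) = ℤ ⊕ K̃⁰(X, x₀)`: `a - rank_{x₀}(a) • [1]` is reduced.
[cite: HusemollerEtAl2008, Ch. 4 Rem. 2.6] -/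
theorem sub_unitHom_rankAt_mem_reduced (x₀ : X) (a : K0 X) :
    a - KZero.unitHom C(X, ℂ) (rankAt x₀ a) ∈ Reduced X x₀ := by
  rw [mem_reduced_iff, map_sub, rankAt_unitHom, sub_self]

/-- `[p] - [q]` is reduced at `x₀` iff `p` and `q` have the same rank at `x₀`.
[cite: HusemollerEtAl2008, Ch. 4 Rem. 2.6] -/
theorem of_sub_of_mem_reduced_iff {x₀ : X} {p q : Idem C(X, ℂ)} :
    KZero.of p - KZero.of q ∈ Reduced X x₀ ↔
      (p.map (evalRingHom x₀)).rank = (q.map (evalRingHom x₀)).rank := by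
  rw [mem_reduced_iff, map_sub, rankAt_of, rankAt_of, sub_eq_zero, Nat.cast_inj]

/-- Pull-back preserves reducedness along pointed maps. [cite: HusemollerEtAl2008, Ch. 4 Rem. 2.6] -/
theorem pullback_mem_reduced {f : C(X, Y)} {x₀ : X} {a : K0 Y} (ha : a ∈ Reduced Y (f x₀)) :
    pullback f a ∈ Reduced X x₀ := by
  rw [mem_reduced_iff, rankAt_pullback]
  exact ha

end Literature.AlgebraicTopology.KTheory

end
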